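/-
Copyright: the b2b-balaban T⁴-continuum CRUX team, row NE7b OWNER lineage `t4-ne7b-p1` (gen 148). Project licence.
-/
import Summits.QuantumFields.BalabanUV.T4Continuum.Spine.NE7b.SupWeightedClassMapOrderFiveStepFive
import Summits.QuantumFields.BalabanUV.T4Continuum.Spine.NE7b.SupWeightedTorusInstance

/-!
# ONE FULL STEP OF THE WEIGHTED CLASS AT ORDER FIVE ON THE ROAD'S TORI, SLOT `s` (FOURTH-INDEX ROLE) — THE GEOMETRY DISCHARGED; (788)'S
# HYPOTHESIS SHAPE SUPPLIED (SCOPING-d20 §C (1), order 5; file (794)).  (782) typed the order-5 step in this role (fluctuation ∘ weighted transport) for an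
# ABSTRACT block map `β` (fibre bound `n`), abstract weights `ϑ`∕`ϑc` with `ϑc(βx,βx′) ≤ M·ϑ(x,x′)`; (786) proved the geometry on the road's tori;
# (788) iterated a bound of exactly this shape at `d = 4` (`|t|⁵·↑((n+1)⁴)·M¹⁰·(…)`, `M = e^{ν₂·4n∕(n+1)}`).  THIS FILE is the INSTANCE of (782):
# fine torus `Site d ((n+1)s)`, coarse torus `Site d s`, torus block map, `ℓ¹` circular distance, `ϑ = e^{νρ}`, `ϑc = e^{νc ρ_s}`: the next
# input's slot-`s` letter `≤ |t|⁵·↑((n+1)^d)·(e^{νc·dn∕(n+1)})¹⁰·B_y` with NO geometric hypothesis — at `d = 4` literally (788)'s `hstep` for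
# `j ↦ j+1` in this role (row NE7b, node U5c; (782), (786) BY NAME; [folklore]; generator `records/gen791.py KEY`; with (789) the role-max).

Cell `pub-balaban`, sub-cell `t4`, spine estimate NE7b (`T4WeightBudget.RelWeightBound`; the cell's OWN estimate — NOT PRINTED in
[Bałaban 1983–89], NOT PROVED).  Crux-route work under `Spine/NE7b/` by the row OWNER (`t4-ne7b-p1` gen 148, file (794)) under FREEZE
(0)'s crux-prover clause; NOTHING of Bałaban's is named as a Lean object, valued or asserted; no `T4Continuum/Support` leaf typed; no
`def`, no notation (block map, distances, weights, `∂⁵W⁺` WRITTEN OUT); zero `sorry`.  Imports (BY NAME): (782) `…SupWeightedClassMapOrderFiveStepFive`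
(`classmap_five_step_s`), (786) `…SupWeightedTorusInstance` (`fibre_card_le`, `torus_block_factor`, `torus_weight_one_le`,
`torus_weight_symm`).

WHAT IS PROVED ([folklore]): **`classmap_five_step_s_torus`**; toy.

HONEST (what this is NOT).  An instance: the analytic class data stay hypotheses; the rates' admissibility is (787); the flow of the letter
VALUES is (784)/(788) (order 5 contracts iff `M¹⁰(1+a) < n+1`, (787)); the sources `B_y − k5ϑ1 − cross terms` bounded = the relevant∕marginal flow, ASSUMED there; scalar
skeleton ((A3), NC-NE7b-α UNRULED); nothing of Bałaban's asserted.  BY-NAME EFFECT ON THE WALL: NONE.  NE7b NOT PRINTED ∕ NOT PROVED; spine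
PROVED 0∕9; rung (B)+1 — the programme's measures remain FINITE-torus statements; NOT the mass gap, NOT Clay.  HONEST DEPENDENCY: continuum YM
on T⁴ ⇐ BetaPertH ∧ nine spine estimates (0∕9 proved); BetaPertH ⇐ (D1) ∧ (D4) ∧ CAP+tail; G-an2-4 gates asym, D1 and NE2∕3∕4.
-/

set_option autoImplicit false
set_option maxSynthPendingDepth 4

noncomputable section

namespace Summit.QuantumFields.BalabanUV.T4Continuum.NE7b.SupWeightedClassMapOrderFiveStepFiveTorus

open MeasureTheory ProbabilityTheory Finset Real Matrix
open scoped BigOperators Matrix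
open Literature.MathematicalPhysics.QuantumFieldTheory.Balaban1983to89
open B6QGQLower276 (blk)
open Beta (Site siteOf windowMap)
open SupWeightedClassMapOrderFiveStepFive (classmap_five_step_s)
open SupWeightedTorusInstance (fibre_card_le torus_block_factor torus_weight_one_le torus_weight_symm torus_weight_pos)

variable {d : ℕ} {κ : Type} [Fintype κ] [DecidableEq κ]
variable {n s : ℕ}
variable {U : EuclideanSpace ℝ (Site d ((n + 1) * s)) → ℝ} {U' : EuclideanSpace ℝ (Site d ((n + 1) * s)) → EuclideanSpace ℝ (Site d ((n + 1) * s)) →L[ℝ] ℝ}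
  {U'' : EuclideanSpace ℝ (Site d ((n + 1) * s)) → EuclideanSpace ℝ (Site d ((n + 1) * s)) →L[ℝ] EuclideanSpace ℝ (Site d ((n + 1) * s)) →L[ℝ] ℝ}
  {U₃ : EuclideanSpace ℝ (Site d ((n + 1) * s)) → EuclideanSpace ℝ (Site d ((n + 1) * s)) →L[ℝ] EuclideanSpace ℝ (Site d ((n + 1) * s)) →L[ℝ] EuclideanSpace ℝ (Site d ((n + 1) * s)) →L[ℝ] ℝ}
  {U₄ : EuclideanSpace ℝ (Site d ((n + 1) * s)) → EuclideanSpace ℝ (Site d ((n + 1) * s)) →L[ℝ] EuclideanSpace ℝ (Site d ((n + 1) * s)) →L[ℝ] EuclideanSpace ℝ (Site d ((n + 1) * s)) →L[ℝ] EuclideanSpace ℝ (Site d ((n + 1) * s))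
        →L[ℝ] ℝ}
  {U₅ : EuclideanSpace ℝ (Site d ((n + 1) * s)) →
    EuclideanSpace ℝ (Site d ((n + 1) * s)) →L[ℝ] EuclideanSpace ℝ (Site d ((n + 1) * s)) →L[ℝ] EuclideanSpace ℝ (Site d ((n + 1) * s)) →L[ℝ] EuclideanSpace ℝ (Site d ((n + 1) * s)) →L[ℝ] EuclideanSpace ℝ (Site d ((n + 1) * s))
        →L[ℝ] ℝ}
  {Hk : (Site d ((n + 1) * s)) → (Site d ((n + 1) * s)) → ℝ} {K3 : (Site d ((n + 1) * s)) → (Site d ((n + 1) * s)) → (Site d ((n + 1) * s)) → ℝ}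
      {K4 : (Site d ((n + 1) * s)) → (Site d ((n + 1) * s)) → (Site d ((n + 1) * s)) → (Site d ((n + 1) * s)) → ℝ}
      {K5 : (Site d ((n + 1) * s)) → (Site d ((n + 1) * s)) → (Site d ((n + 1) * s)) → (Site d ((n + 1) * s)) → (Site d ((n + 1) * s)) → ℝ} {A : Matrix (Site d ((n + 1) * s)) κ ℝ} {D : κ → κ → ℝ}
  {γop κ₀ κ₁ κ₂ κ₃ κ₄ κ₅ κ₅r a τ δ θp lam lamA αr αc hr hc k3r k3c k4r k4c k5r k5c γ dr dc dθ dθ' αθ βθ S S' S₁ n₃ : ℝ} {θ : κ → κ → ℝ}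
  {σ : (Site d ((n + 1) * s)) → κ → ℝ} {ρ r r₁ : (Site d ((n + 1) * s)) → (Site d ((n + 1) * s)) → ℝ} {C3k C3h C4 C5 : ℝ}
  {ϑ₂ : (Site d ((n + 1) * s)) → (Site d ((n + 1) * s)) → ℝ} {αθc αg1m αg2m αg1c αk4m1 αk4m2 αk4m3 αk4c αk5m1 αk5m2 αk5m3 αk5m4 αk5c hrϑ hcϑ k3rϑ k3mϑ k3cϑ k5ϑ1 k5ϑ2 k5ϑ3 k5ϑ4
    k5ϑ5 G Θ8 S2 : ℝ}
variable {σA : (Site d ((n + 1) * s)) → κ → ℝ} {αrσ αcσ : ℝ}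
variable {k4ϑ1 k4ϑ2 k4ϑ3 k4ϑ4 : ℝ}

set_option synthInstance.maxHeartbeats 200000 in
set_option maxHeartbeats 6000000 in
set_option maxRecDepth 4096 in
/-- **ONE FULL STEP AT ORDER 5 ON THE ROAD'S TORI, SLOT `s`** ((782) `classmap_five_step_s` with (786)'s geometry BY NAME): fine torus `(ℤ∕(n+1)s)^d`
over the coarse torus `(ℤ∕s)^d`, block map `x ↦ σ(blk n (wm x))` (fibres of EXACTLY `(n+1)^d` sites), output weight `e^{νρ}` (`ν ≥ 0`),
next-scale weight `e^{νc ρ_s}` with `0 ≤ νc ≤ (n+1)ν` (block factor `M = e^{νc·dn∕(n+1)}`): the next input's fourth-index order-5 letter in the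
slot shape `≤ |t|⁵·(n+1)^d·M¹⁰·B_s` — (788)'s one-step hypothesis shape at `d = 4`, NO abstract geometric hypothesis left. [folklore] -/
theorem classmap_five_step_s_torus [NeZero s] {ν νc : ℝ} [Nonempty (Site d ((n + 1) * s))] [Nonempty κ] (hΓop : (γop • (1 : Matrix (Site d ((n + 1) * s)) (Site d ((n + 1) * s)) ℝ) - A * Aᵀ).PosSemidef)
    (Y : Finset (Site d ((n + 1) * s))) (hUd : ∀ φ : EuclideanSpace ℝ (Site d ((n + 1) * s)), HasFDerivAt U (U' φ) φ) (hU'd : ∀ φ : EuclideanSpace ℝ (Site d ((n + 1) * s)), HasFDerivAt U' (U'' φ) φ)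
    (hU''d : ∀ φ : EuclideanSpace ℝ (Site d ((n + 1) * s)), HasFDerivAt U'' (U₃ φ) φ) (hU₃d : ∀ φ : EuclideanSpace ℝ (Site d ((n + 1) * s)), HasFDerivAt U₃ (U₄ φ) φ)
    (hU₄d : ∀ φ : EuclideanSpace ℝ (Site d ((n + 1) * s)), HasFDerivAt U₄ (U₅ φ) φ) (hU₅c : Continuous U₅) (hκ₀ : 0 ≤ κ₀) (hκ₁ : 0 ≤ κ₁) (ha : 0 ≤ a) (hτ : 0 < τ) (hδ : 0 < δ) (hθ0 : 0 < θp) (hθ1 : θp < 1)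
    (hκθ : (2 * κ₀ * (1 + τ) + 4 * δ) * γop ≤ θp) (hκθw : 2 * κ₀ * (1 + τ) * γop + 4 * δ ≤ θp) (hstab : ∀ φ : EuclideanSpace ℝ (Site d ((n + 1) * s)), -(κ₀ * ∑ x ∈ Y, φ x ^ 2) ≤ U φ)
    (hU'b : ∀ φ : EuclideanSpace ℝ (Site d ((n + 1) * s)), ‖U' φ‖ ≤ κ₁ * (a + ∑ x ∈ Y, φ x ^ 2)) (hU''b : ∀ φ : EuclideanSpace ℝ (Site d ((n + 1) * s)), ‖U'' φ‖ ≤ κ₂)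
    (hU₃b : ∀ φ : EuclideanSpace ℝ (Site d ((n + 1) * s)), ‖U₃ φ‖ ≤ κ₃) (hU₄b : ∀ φ : EuclideanSpace ℝ (Site d ((n + 1) * s)), ‖U₄ φ‖ ≤ κ₄) (hU₅b : ∀ φ : EuclideanSpace ℝ (Site d ((n + 1) * s)), ‖U₅ φ‖ ≤ κ₅) (hlam : 0 ≤ lam)
    (hUsec : ∀ sc : ℝ, 0 ≤ sc → sc ≤ 1 → ∀ a b : EuclideanSpace ℝ (Site d ((n + 1) * s)), U ((1 - sc) • a + sc • b) - lam / 2 * (sc * (1 - sc)) * ∑ i, (a i - b i) ^ 2 ≤ (1 - sc) * U a + sc * U b) (hρg : lam * γop < 1)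
    (hHk : ∀ (φ : EuclideanSpace ℝ (Site d ((n + 1) * s))) (x z : (Site d ((n + 1) * s))), |U'' φ (EuclideanSpace.single z (1 : ℝ)) (EuclideanSpace.single x (1 : ℝ))| ≤ Hk x z) (hHk0 : ∀ v u, 0 ≤ Hk v u)
    (hK3 : ∀ (φ : EuclideanSpace ℝ (Site d ((n + 1) * s))) (u x y : (Site d ((n + 1) * s))), |U₃ φ (EuclideanSpace.single u (1 : ℝ)) (EuclideanSpace.single x (1 : ℝ)) (EuclideanSpace.single y (1 : ℝ))| ≤ K3 x y u)
    (hK30 : ∀ x y u, 0 ≤ K3 x y u)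
    (hK4 : ∀ (φ : EuclideanSpace ℝ (Site d ((n + 1) * s))) (u x y z : (Site d ((n + 1) * s))), |U₄ φ (EuclideanSpace.single u (1 : ℝ)) (EuclideanSpace.single x (1 : ℝ)) (EuclideanSpace.single y (1 : ℝ))
      (EuclideanSpace.single z (1 : ℝ))| ≤ K4 x y z u) (hK40 : ∀ x y z u, 0 ≤ K4 x y z u)
    (hK5 : ∀ (φ : EuclideanSpace ℝ (Site d ((n + 1) * s))) (u x y z t : (Site d ((n + 1) * s))), |U₅ φ (EuclideanSpace.single u (1 : ℝ)) (EuclideanSpace.single x (1 : ℝ)) (EuclideanSpace.single y (1 : ℝ))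
      (EuclideanSpace.single z (1 : ℝ)) (EuclideanSpace.single t (1 : ℝ))| ≤ K5 x y z t u) (hhr : ∀ v, ∑ u, Hk v u ≤ hr) (ψ : EuclideanSpace ℝ (Site d ((n + 1) * s))) (hαr : ∀ u, ∑ w, |A u w| ≤ αr) (hαc : ∀ w, ∑ u, |A u w| ≤ αc)
    (hlamA : ∀ x : κ, ∑ u, ∑ v, |A u x| * |A v x| * Hk v u ≤ lamA) (hlamA1 : lamA < 1) (hγ : αc * hr * αr / (1 - lamA) ≤ γ) (hγ1 : γ < 1) (hD : ∀ x y, 0 ≤ D x y)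
    (hDC : ∀ x y, (if x = y then (1 : ℝ) else 0) + ∑ z, D x z * ((if y = z then 0 else ∑ u, ∑ v, |A u y| * |A v z| * Hk v u) / (1 - lamA)) ≤ D x y) (hθnn : ∀ z w, 0 ≤ θ z w) (hDθr : ∀ z, ∑ w, D z w * θ z w ≤ dθ) (hdθ : 0 ≤ dθ)
    (hDθc : ∀ w, ∑ z, D z w * θ z w ≤ dθ') (hdθ' : 0 ≤ dθ') (hσ0 : ∀ x w, 0 ≤ σ x w) (hσθ : ∀ x z w, σ x w ≤ σ x z * θ z w) (hρ1 : ∀ x y, 1 ≤ ρ x y) (hρsymm : ∀ x y, ρ x y = ρ y x) (hρmul : ∀ x y z, ρ x z ≤ ρ x y * ρ y z)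
    (hρσ : ∀ x y w, ρ x y ^ 8 ≤ σ x w * σ y w) (hr1 : ∀ x y, 1 ≤ r x y) (hrσ : ∀ x y w, r x y ^ 24 ≤ σ x w * σ y w)
    (hC3k : 4 * Real.sqrt ((5 * ((κ₂ ^ 4 + κ₄ ^ 4) * γop ^ 2) / (1 - lam * γop) ^ 2) * (αθ * dθ * (βθ * dθ') / (1 - lamA))) ≤ C3k)
    (hC3h : 4 * Real.sqrt ((5 * ((κ₂ ^ 4 + κ₃ ^ 4) * γop ^ 2) / (1 - lam * γop) ^ 2) * (αθ * dθ * (βθ * dθ') / (1 - lamA))) ≤ C3h)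
    (hC4 :
      (4 * (αθ * dθ * (βθ * dθ') / (1 - lamA)) + 3 * (αθ * dθ * (βθ * dθ') / (1 - lamA)) ^ 2 + 4 * (5 * ((κ₂ ^ 4 + κ₃ ^ 4) * γop ^ 2) / (1 - lam * γop) ^ 2) + 4 * (50 * ((κ₂ ^ 6 + κ₃ ^ 6) * γop ^ 3) / (1 - lam * γop) ^ 3) + 2 *
        (((5 * ((κ₂ ^ 4 + κ₃ ^ 4) * γop ^ 2) / (1 - lam * γop) ^ 2) + 1) / 2) * ((((5 * ((κ₂ ^ 4 + κ₃ ^ 4) * γop ^ 2) / (1 - lam * γop) ^ 2) + 1) / 2) + (5 * ((κ₂ ^ 4 + κ₃ ^ 4) * γop ^ 2) / (1 - lam * γop) ^ 2))) ≤ C4)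
    (hC5 :
      ((4 * (αθ * dθ * (βθ * dθ') / (1 - lamA)) + 5 * (50 * (κ₂ ^ 6 * γop ^ 3) / (1 - lam * γop) ^ 3) + (((5 * (κ₂ ^ 4 * γop ^ 2) / (1 - lam * γop) ^ 2) + 1) / 2) * (5 * (κ₂ ^ 4 * γop ^ 2) / (1 - lam * γop) ^ 2) + 2 *
          (αθ * dθ * (βθ * dθ') / (1 - lamA)) * ((((5 * (κ₂ ^ 4 * γop ^ 2) / (1 - lam * γop) ^ 2) + 1) / 2) + (5 * (κ₂ ^ 4 * γop ^ 2) / (1 - lam * γop) ^ 2)) + 24 * (((5 * (κ₂ ^ 4 * γop ^ 2) / (1 - lam * γop) ^ 2) + 1) / 2) *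
          Real.sqrt ((αθ * dθ * (βθ * dθ') / (1 - lamA)) * (5 * (κ₂ ^ 4 * γop ^ 2) / (1 - lam * γop) ^ 2))) +
        (6 * (αθ * dθ * (βθ * dθ') / (1 - lamA)) + 5 * (50 * (κ₂ ^ 6 * γop ^ 3) / (1 - lam * γop) ^ 3) + ((((5 * (κ₂ ^ 4 * γop ^ 2) / (1 - lam * γop) ^ 2) + 1) / 2) + (5 * (κ₂ ^ 4 * γop ^ 2) / (1 - lam * γop) ^ 2)) ^ 2 / 2 + 3 *
          (((5 * (κ₂ ^ 4 * γop ^ 2) / (1 - lam * γop) ^ 2) + 1) / 2) * (5 * (κ₂ ^ 4 * γop ^ 2) / (1 - lam * γop) ^ 2) + 3 * (αθ * dθ * (βθ * dθ') / (1 - lamA)) *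
          ((((5 * (κ₂ ^ 4 * γop ^ 2) / (1 - lam * γop) ^ 2) + 1) / 2) + (5 * (κ₂ ^ 4 * γop ^ 2) / (1 - lam * γop) ^ 2)) + 12 * (((5 * (κ₂ ^ 4 * γop ^ 2) / (1 - lam * γop) ^ 2) + 1) / 2) * Real.sqrt
          ((αθ * dθ * (βθ * dθ') / (1 - lamA)) * (5 * (κ₂ ^ 4 * γop ^ 2) / (1 - lam * γop) ^ 2)))) ≤ C5) (hr₁1 : ∀ x y, 1 ≤ r₁ x y) (hr₁symm : ∀ x y, r₁ x y = r₁ y x) (hr₁mul : ∀ x y z, r₁ x z ≤ r₁ x y * r₁ y z)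
    (hr₁8 : ∀ x y, r₁ x y ^ 8 ≤ r x y) (hC40 : 0 ≤ C4) (hC50 : 0 ≤ C5)
    (hϑmul : ∀ x y z : (Site d ((n + 1) * s)), Real.exp (ν * ∑ i, (((x i - z i).valMinAbs.natAbs : ℕ) : ℝ)) ≤ Real.exp (ν * ∑ i, (((x i - y i).valMinAbs.natAbs : ℕ) : ℝ)) * Real.exp
      (ν * ∑ i, (((y i - z i).valMinAbs.natAbs : ℕ) : ℝ))) (hϑ4 : ∀ x y, Real.exp (ν * ∑ i, (((x i - y i).valMinAbs.natAbs : ℕ) : ℝ)) ^ 4 ≤ ϑ₂ x y) (hϑ₂symm : ∀ x y, ϑ₂ x y = ϑ₂ y x)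
    (hϑσ6 : ∀ x y w, Real.exp (ν * ∑ i, (((x i - y i).valMinAbs.natAbs : ℕ) : ℝ)) ^ 6 ≤ σ x w * σ y w) (hϑr₁ : ∀ x y, Real.exp (ν * ∑ i, (((x i - y i).valMinAbs.natAbs : ℕ) : ℝ)) ≤ r₁ x y)
    (hG : ∀ a, ∑ b, Real.exp (ν * ∑ i, (((a i - b i).valMinAbs.natAbs : ℕ) : ℝ)) ^ 6 / Real.sqrt (ρ a b) ≤ G) (hΘ : ∀ a, ∑ b, (Real.exp (ν * ∑ i, (((a i - b i).valMinAbs.natAbs : ℕ) : ℝ)) ^ 4) ^ 2 / ϑ₂ a b ≤ Θ8)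
    (hS2 : ∀ a, ∑ b, Real.exp (ν * ∑ i, (((a i - b i).valMinAbs.natAbs : ℕ) : ℝ)) ^ 2 / r₁ a b ≤ S2) (hhrw : ∀ v, ∑ u, ϑ₂ v u * Hk v u ≤ hrϑ) (hhc : ∀ a, ∑ b, ϑ₂ a b * Hk b a ≤ hcϑ)
    (hk3m : ∀ y, ∑ x, ∑ v, K3 x y v * (ϑ₂ y x * ϑ₂ y v * ϑ₂ x v) ≤ k3mϑ) (hk3c : ∀ v, ∑ y, ∑ z, K3 y z v * (ϑ₂ v y * ϑ₂ v z * ϑ₂ y z) ≤ k3cϑ)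
    (hk5 : ∀ sc, ∑ x, ∑ y, ∑ z, ∑ t, K5 y z t sc x * (ϑ₂ x y * ϑ₂ x z * ϑ₂ x t * ϑ₂ x sc * ϑ₂ y z * ϑ₂ y t * ϑ₂ y sc * ϑ₂ z t * ϑ₂ z sc * ϑ₂ t sc) ≤ k5ϑ4) (hσA0 : ∀ u z', 0 ≤ σA u z') (hσϑ₂ : ∀ v u z', σ v z' ≤ ϑ₂ v u * σA u z')
    (hAr : ∀ u, ∑ z', |A u z'| * σA u z' ≤ αrσ) (hAc : ∀ z', ∑ u, |A u z'| * σA u z' ≤ αcσ) (hαcσ0 : 0 ≤ αcσ) (hk3r : ∀ x, ∑ y, ∑ v, K3 x y v * (ϑ₂ x y * ϑ₂ x v * ϑ₂ y v) ≤ k3rϑ)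
    (hk4y : ∀ y, ∑ x, ∑ z, ∑ t, K4 y z t x * (ϑ₂ x y * ϑ₂ x z * ϑ₂ x t * ϑ₂ y z * ϑ₂ y t * ϑ₂ z t) ≤ k4ϑ1) (hk4t : ∀ t, ∑ x, ∑ y, ∑ z, K4 y z t x * (ϑ₂ x y * ϑ₂ x z * ϑ₂ x t * ϑ₂ y z * ϑ₂ y t * ϑ₂ z t) ≤ k4ϑ3)
    (hk4x : ∀ x, ∑ y, ∑ z, ∑ t, K4 y z t x * (ϑ₂ x y * ϑ₂ x z * ϑ₂ x t * ϑ₂ y z * ϑ₂ y t * ϑ₂ z t) ≤ k4ϑ4)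
    (hk5x : ∀ x, ∑ y, ∑ z, ∑ t, ∑ sc, K5 y z t sc x * (ϑ₂ x y * ϑ₂ x z * ϑ₂ x t * ϑ₂ x sc * ϑ₂ y z * ϑ₂ y t * ϑ₂ y sc * ϑ₂ z t * ϑ₂ z sc * ϑ₂ t sc) ≤ k5ϑ5) (hαθ : hrϑ * αrσ ≤ αθ) (hαθ' : k3rϑ * αrσ ≤ αθ) (hαθ'' : k4ϑ1 * αrσ ≤ αθ)
    (hαβ : αθ ≤ βθ) (hαθc : hcϑ * αcσ ≤ αθc) (hαg2m : k3mϑ * αrσ ≤ αg2m) (hαg1c : k3cϑ * αcσ ≤ αg1c) (hαk4m3 : k4ϑ3 * αrσ ≤ αk4m3) (hαk4c : k4ϑ4 * αcσ ≤ αk4c) (hαk5m4 : k5ϑ4 * αrσ ≤ αk5m4) (hαk5c : k5ϑ5 * αcσ ≤ αk5c)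
    (hν : 0 ≤ ν) (hνc : 0 ≤ νc) (hrate : νc ≤ ((n : ℝ) + 1) * ν) (t : ℝ) (y₁ : Site d s) :
    ∑ Xc, ∑ Yc, ∑ Zc, ∑ Tc,
        (|t| ^ 5 * ∑ y ∈ Finset.univ.filter (fun y => siteOf d s (blk n (windowMap d ((n + 1) * s) y)) = Yc), ∑ z ∈ Finset.univ.filter (fun z => siteOf d s (blk n (windowMap d ((n + 1) * s) z)) = Zc), ∑ tt ∈ Finset.univ.filter
          (fun tt => siteOf d s (blk n (windowMap d ((n + 1) * s) tt)) = Tc), ∑ s₅ ∈ Finset.univ.filter (fun s₅ => siteOf d s (blk n (windowMap d ((n + 1) * s) s₅)) = y₁), ∑ x ∈ Finset.univ.filter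
          (fun x => siteOf d s (blk n (windowMap d ((n + 1) * s) x)) = Xc), |lineDeriv ℝ
          (fun ψ' : EuclideanSpace ℝ (Site d ((n + 1) * s)) => (∫ ω : EuclideanSpace ℝ (Site d ((n + 1) * s)), exp (-U (ω + ψ')) ∂(multivariateGaussian 0 (A * Aᵀ)))⁻¹ *
            (∫ ω : EuclideanSpace ℝ (Site d ((n + 1) * s)), exp (-U (ω + ψ')) * U₄ (ω + ψ') (EuclideanSpace.single y (1 : ℝ)) (EuclideanSpace.single z (1 : ℝ)) (EuclideanSpace.single tt (1 : ℝ)) (EuclideanSpace.single s₅ (1 : ℝ))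
              ∂(multivariateGaussian 0 (A * Aᵀ))) -
            (((∫ ω : EuclideanSpace ℝ (Site d ((n + 1) * s)), exp (-U (ω + ψ')) ∂(multivariateGaussian 0 (A * Aᵀ)))⁻¹ *
                (∫ ω : EuclideanSpace ℝ (Site d ((n + 1) * s)), exp (-U (ω + ψ')) *
                  (U₃ (ω + ψ') (EuclideanSpace.single y (1 : ℝ)) (EuclideanSpace.single tt (1 : ℝ)) (EuclideanSpace.single s₅ (1 : ℝ)) * U' (ω + ψ') (EuclideanSpace.single z (1 : ℝ))) ∂(multivariateGaussian 0 (A * Aᵀ))) -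
                ((∫ ω : EuclideanSpace ℝ (Site d ((n + 1) * s)), exp (-U (ω + ψ')) ∂(multivariateGaussian 0 (A * Aᵀ))) ^ 2)⁻¹ *
                ((∫ ω : EuclideanSpace ℝ (Site d ((n + 1) * s)), exp (-U (ω + ψ')) * U₃ (ω + ψ') (EuclideanSpace.single y (1 : ℝ)) (EuclideanSpace.single tt (1 : ℝ)) (EuclideanSpace.single s₅ (1 : ℝ))
                    ∂(multivariateGaussian 0 (A * Aᵀ))) * (∫ ω : EuclideanSpace ℝ (Site d ((n + 1) * s)), exp (-U (ω + ψ')) * U' (ω + ψ') (EuclideanSpace.single z (1 : ℝ)) ∂(multivariateGaussian 0 (A * Aᵀ))))) +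
              ((∫ ω : EuclideanSpace ℝ (Site d ((n + 1) * s)), exp (-U (ω + ψ')) ∂(multivariateGaussian 0 (A * Aᵀ)))⁻¹ *
                (∫ ω : EuclideanSpace ℝ (Site d ((n + 1) * s)), exp (-U (ω + ψ')) *
                  (U₃ (ω + ψ') (EuclideanSpace.single y (1 : ℝ)) (EuclideanSpace.single z (1 : ℝ)) (EuclideanSpace.single s₅ (1 : ℝ)) * U' (ω + ψ') (EuclideanSpace.single tt (1 : ℝ))) ∂(multivariateGaussian 0 (A * Aᵀ))) -
                ((∫ ω : EuclideanSpace ℝ (Site d ((n + 1) * s)), exp (-U (ω + ψ')) ∂(multivariateGaussian 0 (A * Aᵀ))) ^ 2)⁻¹ *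
                ((∫ ω : EuclideanSpace ℝ (Site d ((n + 1) * s)), exp (-U (ω + ψ')) * U₃ (ω + ψ') (EuclideanSpace.single y (1 : ℝ)) (EuclideanSpace.single z (1 : ℝ)) (EuclideanSpace.single s₅ (1 : ℝ))
                    ∂(multivariateGaussian 0 (A * Aᵀ))) * (∫ ω : EuclideanSpace ℝ (Site d ((n + 1) * s)), exp (-U (ω + ψ')) * U' (ω + ψ') (EuclideanSpace.single tt (1 : ℝ)) ∂(multivariateGaussian 0 (A * Aᵀ))))) +
              ((∫ ω : EuclideanSpace ℝ (Site d ((n + 1) * s)), exp (-U (ω + ψ')) ∂(multivariateGaussian 0 (A * Aᵀ)))⁻¹ *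
                (∫ ω : EuclideanSpace ℝ (Site d ((n + 1) * s)), exp (-U (ω + ψ')) *
                  (U₃ (ω + ψ') (EuclideanSpace.single y (1 : ℝ)) (EuclideanSpace.single z (1 : ℝ)) (EuclideanSpace.single tt (1 : ℝ)) * U' (ω + ψ') (EuclideanSpace.single s₅ (1 : ℝ))) ∂(multivariateGaussian 0 (A * Aᵀ))) -
                ((∫ ω : EuclideanSpace ℝ (Site d ((n + 1) * s)), exp (-U (ω + ψ')) ∂(multivariateGaussian 0 (A * Aᵀ))) ^ 2)⁻¹ *
                ((∫ ω : EuclideanSpace ℝ (Site d ((n + 1) * s)), exp (-U (ω + ψ')) * U₃ (ω + ψ') (EuclideanSpace.single y (1 : ℝ)) (EuclideanSpace.single z (1 : ℝ)) (EuclideanSpace.single tt (1 : ℝ))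
                    ∂(multivariateGaussian 0 (A * Aᵀ))) * (∫ ω : EuclideanSpace ℝ (Site d ((n + 1) * s)), exp (-U (ω + ψ')) * U' (ω + ψ') (EuclideanSpace.single s₅ (1 : ℝ)) ∂(multivariateGaussian 0 (A * Aᵀ))))) +
              ((∫ ω : EuclideanSpace ℝ (Site d ((n + 1) * s)), exp (-U (ω + ψ')) ∂(multivariateGaussian 0 (A * Aᵀ)))⁻¹ *
                (∫ ω : EuclideanSpace ℝ (Site d ((n + 1) * s)), exp (-U (ω + ψ')) *
                  (U' (ω + ψ') (EuclideanSpace.single y (1 : ℝ)) * U₃ (ω + ψ') (EuclideanSpace.single z (1 : ℝ)) (EuclideanSpace.single tt (1 : ℝ)) (EuclideanSpace.single s₅ (1 : ℝ))) ∂(multivariateGaussian 0 (A * Aᵀ))) -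
                ((∫ ω : EuclideanSpace ℝ (Site d ((n + 1) * s)), exp (-U (ω + ψ')) ∂(multivariateGaussian 0 (A * Aᵀ))) ^ 2)⁻¹ *
                ((∫ ω : EuclideanSpace ℝ (Site d ((n + 1) * s)), exp (-U (ω + ψ')) * U' (ω + ψ') (EuclideanSpace.single y (1 : ℝ)) ∂(multivariateGaussian 0 (A * Aᵀ))) *
                  (∫ ω : EuclideanSpace ℝ (Site d ((n + 1) * s)), exp (-U (ω + ψ')) * U₃ (ω + ψ') (EuclideanSpace.single z (1 : ℝ)) (EuclideanSpace.single tt (1 : ℝ)) (EuclideanSpace.single s₅ (1 : ℝ))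
                    ∂(multivariateGaussian 0 (A * Aᵀ)))))) -
            (((∫ ω : EuclideanSpace ℝ (Site d ((n + 1) * s)), exp (-U (ω + ψ')) ∂(multivariateGaussian 0 (A * Aᵀ)))⁻¹ *
                (∫ ω : EuclideanSpace ℝ (Site d ((n + 1) * s)), exp (-U (ω + ψ')) *
                  (U'' (ω + ψ') (EuclideanSpace.single y (1 : ℝ)) (EuclideanSpace.single z (1 : ℝ)) * U'' (ω + ψ') (EuclideanSpace.single tt (1 : ℝ)) (EuclideanSpace.single s₅ (1 : ℝ))) ∂(multivariateGaussian 0 (A * Aᵀ))) -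
                ((∫ ω : EuclideanSpace ℝ (Site d ((n + 1) * s)), exp (-U (ω + ψ')) ∂(multivariateGaussian 0 (A * Aᵀ))) ^ 2)⁻¹ *
                ((∫ ω : EuclideanSpace ℝ (Site d ((n + 1) * s)), exp (-U (ω + ψ')) * U'' (ω + ψ') (EuclideanSpace.single y (1 : ℝ)) (EuclideanSpace.single z (1 : ℝ)) ∂(multivariateGaussian 0 (A * Aᵀ))) *
                  (∫ ω : EuclideanSpace ℝ (Site d ((n + 1) * s)), exp (-U (ω + ψ')) * U'' (ω + ψ') (EuclideanSpace.single tt (1 : ℝ)) (EuclideanSpace.single s₅ (1 : ℝ)) ∂(multivariateGaussian 0 (A * Aᵀ))))) +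
              ((∫ ω : EuclideanSpace ℝ (Site d ((n + 1) * s)), exp (-U (ω + ψ')) ∂(multivariateGaussian 0 (A * Aᵀ)))⁻¹ *
                (∫ ω : EuclideanSpace ℝ (Site d ((n + 1) * s)), exp (-U (ω + ψ')) *
                  (U'' (ω + ψ') (EuclideanSpace.single y (1 : ℝ)) (EuclideanSpace.single tt (1 : ℝ)) * U'' (ω + ψ') (EuclideanSpace.single z (1 : ℝ)) (EuclideanSpace.single s₅ (1 : ℝ))) ∂(multivariateGaussian 0 (A * Aᵀ))) -
                ((∫ ω : EuclideanSpace ℝ (Site d ((n + 1) * s)), exp (-U (ω + ψ')) ∂(multivariateGaussian 0 (A * Aᵀ))) ^ 2)⁻¹ *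
                ((∫ ω : EuclideanSpace ℝ (Site d ((n + 1) * s)), exp (-U (ω + ψ')) * U'' (ω + ψ') (EuclideanSpace.single y (1 : ℝ)) (EuclideanSpace.single tt (1 : ℝ)) ∂(multivariateGaussian 0 (A * Aᵀ))) *
                  (∫ ω : EuclideanSpace ℝ (Site d ((n + 1) * s)), exp (-U (ω + ψ')) * U'' (ω + ψ') (EuclideanSpace.single z (1 : ℝ)) (EuclideanSpace.single s₅ (1 : ℝ)) ∂(multivariateGaussian 0 (A * Aᵀ))))) +
              ((∫ ω : EuclideanSpace ℝ (Site d ((n + 1) * s)), exp (-U (ω + ψ')) ∂(multivariateGaussian 0 (A * Aᵀ)))⁻¹ *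
                (∫ ω : EuclideanSpace ℝ (Site d ((n + 1) * s)), exp (-U (ω + ψ')) *
                  (U'' (ω + ψ') (EuclideanSpace.single y (1 : ℝ)) (EuclideanSpace.single s₅ (1 : ℝ)) * U'' (ω + ψ') (EuclideanSpace.single z (1 : ℝ)) (EuclideanSpace.single tt (1 : ℝ))) ∂(multivariateGaussian 0 (A * Aᵀ))) -
                ((∫ ω : EuclideanSpace ℝ (Site d ((n + 1) * s)), exp (-U (ω + ψ')) ∂(multivariateGaussian 0 (A * Aᵀ))) ^ 2)⁻¹ *
                ((∫ ω : EuclideanSpace ℝ (Site d ((n + 1) * s)), exp (-U (ω + ψ')) * U'' (ω + ψ') (EuclideanSpace.single y (1 : ℝ)) (EuclideanSpace.single s₅ (1 : ℝ)) ∂(multivariateGaussian 0 (A * Aᵀ))) *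
                  (∫ ω : EuclideanSpace ℝ (Site d ((n + 1) * s)), exp (-U (ω + ψ')) * U'' (ω + ψ') (EuclideanSpace.single z (1 : ℝ)) (EuclideanSpace.single tt (1 : ℝ)) ∂(multivariateGaussian 0 (A * Aᵀ)))))) +
            ((∫ ω : EuclideanSpace ℝ (Site d ((n + 1) * s)), exp (-U (ω + ψ')) ∂(multivariateGaussian 0 (A * Aᵀ)))⁻¹ *
              (∫ ω : EuclideanSpace ℝ (Site d ((n + 1) * s)), exp (-U (ω + ψ')) *
                ((U'' (ω + ψ') (EuclideanSpace.single y (1 : ℝ)) (EuclideanSpace.single z (1 : ℝ)) -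
                    ((∫ ω : EuclideanSpace ℝ (Site d ((n + 1) * s)), exp (-U (ω + ψ')) ∂(multivariateGaussian 0 (A * Aᵀ)))⁻¹ *
                      (∫ ω : EuclideanSpace ℝ (Site d ((n + 1) * s)), exp (-U (ω + ψ')) * U'' (ω + ψ') (EuclideanSpace.single y (1 : ℝ)) (EuclideanSpace.single z (1 : ℝ)) ∂(multivariateGaussian 0 (A * Aᵀ))))) *
                  (U' (ω + ψ') (EuclideanSpace.single tt (1 : ℝ)) -
                    ((∫ ω : EuclideanSpace ℝ (Site d ((n + 1) * s)), exp (-U (ω + ψ')) ∂(multivariateGaussian 0 (A * Aᵀ)))⁻¹ *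
                      (∫ ω : EuclideanSpace ℝ (Site d ((n + 1) * s)), exp (-U (ω + ψ')) * U' (ω + ψ') (EuclideanSpace.single tt (1 : ℝ)) ∂(multivariateGaussian 0 (A * Aᵀ))))) *
                  (U' (ω + ψ') (EuclideanSpace.single s₅ (1 : ℝ)) -
                    ((∫ ω : EuclideanSpace ℝ (Site d ((n + 1) * s)), exp (-U (ω + ψ')) ∂(multivariateGaussian 0 (A * Aᵀ)))⁻¹ *
                      (∫ ω : EuclideanSpace ℝ (Site d ((n + 1) * s)), exp (-U (ω + ψ')) * U' (ω + ψ') (EuclideanSpace.single s₅ (1 : ℝ)) ∂(multivariateGaussian 0 (A * Aᵀ)))))) ∂(multivariateGaussian 0 (A * Aᵀ))) +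
              (∫ ω : EuclideanSpace ℝ (Site d ((n + 1) * s)), exp (-U (ω + ψ')) ∂(multivariateGaussian 0 (A * Aᵀ)))⁻¹ *
              (∫ ω : EuclideanSpace ℝ (Site d ((n + 1) * s)), exp (-U (ω + ψ')) *
                ((U'' (ω + ψ') (EuclideanSpace.single y (1 : ℝ)) (EuclideanSpace.single tt (1 : ℝ)) -
                    ((∫ ω : EuclideanSpace ℝ (Site d ((n + 1) * s)), exp (-U (ω + ψ')) ∂(multivariateGaussian 0 (A * Aᵀ)))⁻¹ *
                      (∫ ω : EuclideanSpace ℝ (Site d ((n + 1) * s)), exp (-U (ω + ψ')) * U'' (ω + ψ') (EuclideanSpace.single y (1 : ℝ)) (EuclideanSpace.single tt (1 : ℝ)) ∂(multivariateGaussian 0 (A * Aᵀ))))) *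
                  (U' (ω + ψ') (EuclideanSpace.single z (1 : ℝ)) -
                    ((∫ ω : EuclideanSpace ℝ (Site d ((n + 1) * s)), exp (-U (ω + ψ')) ∂(multivariateGaussian 0 (A * Aᵀ)))⁻¹ *
                      (∫ ω : EuclideanSpace ℝ (Site d ((n + 1) * s)), exp (-U (ω + ψ')) * U' (ω + ψ') (EuclideanSpace.single z (1 : ℝ)) ∂(multivariateGaussian 0 (A * Aᵀ))))) *
                  (U' (ω + ψ') (EuclideanSpace.single s₅ (1 : ℝ)) -
                    ((∫ ω : EuclideanSpace ℝ (Site d ((n + 1) * s)), exp (-U (ω + ψ')) ∂(multivariateGaussian 0 (A * Aᵀ)))⁻¹ *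
                      (∫ ω : EuclideanSpace ℝ (Site d ((n + 1) * s)), exp (-U (ω + ψ')) * U' (ω + ψ') (EuclideanSpace.single s₅ (1 : ℝ)) ∂(multivariateGaussian 0 (A * Aᵀ)))))) ∂(multivariateGaussian 0 (A * Aᵀ))) +
              (∫ ω : EuclideanSpace ℝ (Site d ((n + 1) * s)), exp (-U (ω + ψ')) ∂(multivariateGaussian 0 (A * Aᵀ)))⁻¹ *
              (∫ ω : EuclideanSpace ℝ (Site d ((n + 1) * s)), exp (-U (ω + ψ')) *
                ((U'' (ω + ψ') (EuclideanSpace.single y (1 : ℝ)) (EuclideanSpace.single s₅ (1 : ℝ)) -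
                    ((∫ ω : EuclideanSpace ℝ (Site d ((n + 1) * s)), exp (-U (ω + ψ')) ∂(multivariateGaussian 0 (A * Aᵀ)))⁻¹ *
                      (∫ ω : EuclideanSpace ℝ (Site d ((n + 1) * s)), exp (-U (ω + ψ')) * U'' (ω + ψ') (EuclideanSpace.single y (1 : ℝ)) (EuclideanSpace.single s₅ (1 : ℝ)) ∂(multivariateGaussian 0 (A * Aᵀ))))) *
                  (U' (ω + ψ') (EuclideanSpace.single z (1 : ℝ)) -
                    ((∫ ω : EuclideanSpace ℝ (Site d ((n + 1) * s)), exp (-U (ω + ψ')) ∂(multivariateGaussian 0 (A * Aᵀ)))⁻¹ *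
                      (∫ ω : EuclideanSpace ℝ (Site d ((n + 1) * s)), exp (-U (ω + ψ')) * U' (ω + ψ') (EuclideanSpace.single z (1 : ℝ)) ∂(multivariateGaussian 0 (A * Aᵀ))))) *
                  (U' (ω + ψ') (EuclideanSpace.single tt (1 : ℝ)) -
                    ((∫ ω : EuclideanSpace ℝ (Site d ((n + 1) * s)), exp (-U (ω + ψ')) ∂(multivariateGaussian 0 (A * Aᵀ)))⁻¹ *
                      (∫ ω : EuclideanSpace ℝ (Site d ((n + 1) * s)), exp (-U (ω + ψ')) * U' (ω + ψ') (EuclideanSpace.single tt (1 : ℝ)) ∂(multivariateGaussian 0 (A * Aᵀ)))))) ∂(multivariateGaussian 0 (A * Aᵀ))) +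
              (∫ ω : EuclideanSpace ℝ (Site d ((n + 1) * s)), exp (-U (ω + ψ')) ∂(multivariateGaussian 0 (A * Aᵀ)))⁻¹ *
              (∫ ω : EuclideanSpace ℝ (Site d ((n + 1) * s)), exp (-U (ω + ψ')) *
                ((U' (ω + ψ') (EuclideanSpace.single y (1 : ℝ)) -
                    ((∫ ω : EuclideanSpace ℝ (Site d ((n + 1) * s)), exp (-U (ω + ψ')) ∂(multivariateGaussian 0 (A * Aᵀ)))⁻¹ *
                      (∫ ω : EuclideanSpace ℝ (Site d ((n + 1) * s)), exp (-U (ω + ψ')) * U' (ω + ψ') (EuclideanSpace.single y (1 : ℝ)) ∂(multivariateGaussian 0 (A * Aᵀ))))) *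
                  (U'' (ω + ψ') (EuclideanSpace.single z (1 : ℝ)) (EuclideanSpace.single tt (1 : ℝ)) -
                    ((∫ ω : EuclideanSpace ℝ (Site d ((n + 1) * s)), exp (-U (ω + ψ')) ∂(multivariateGaussian 0 (A * Aᵀ)))⁻¹ *
                      (∫ ω : EuclideanSpace ℝ (Site d ((n + 1) * s)), exp (-U (ω + ψ')) * U'' (ω + ψ') (EuclideanSpace.single z (1 : ℝ)) (EuclideanSpace.single tt (1 : ℝ)) ∂(multivariateGaussian 0 (A * Aᵀ))))) *
                  (U' (ω + ψ') (EuclideanSpace.single s₅ (1 : ℝ)) -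
                    ((∫ ω : EuclideanSpace ℝ (Site d ((n + 1) * s)), exp (-U (ω + ψ')) ∂(multivariateGaussian 0 (A * Aᵀ)))⁻¹ *
                      (∫ ω : EuclideanSpace ℝ (Site d ((n + 1) * s)), exp (-U (ω + ψ')) * U' (ω + ψ') (EuclideanSpace.single s₅ (1 : ℝ)) ∂(multivariateGaussian 0 (A * Aᵀ)))))) ∂(multivariateGaussian 0 (A * Aᵀ))) +
              (∫ ω : EuclideanSpace ℝ (Site d ((n + 1) * s)), exp (-U (ω + ψ')) ∂(multivariateGaussian 0 (A * Aᵀ)))⁻¹ *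
              (∫ ω : EuclideanSpace ℝ (Site d ((n + 1) * s)), exp (-U (ω + ψ')) *
                ((U' (ω + ψ') (EuclideanSpace.single y (1 : ℝ)) -
                    ((∫ ω : EuclideanSpace ℝ (Site d ((n + 1) * s)), exp (-U (ω + ψ')) ∂(multivariateGaussian 0 (A * Aᵀ)))⁻¹ *
                      (∫ ω : EuclideanSpace ℝ (Site d ((n + 1) * s)), exp (-U (ω + ψ')) * U' (ω + ψ') (EuclideanSpace.single y (1 : ℝ)) ∂(multivariateGaussian 0 (A * Aᵀ))))) *
                  (U'' (ω + ψ') (EuclideanSpace.single z (1 : ℝ)) (EuclideanSpace.single s₅ (1 : ℝ)) -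
                    ((∫ ω : EuclideanSpace ℝ (Site d ((n + 1) * s)), exp (-U (ω + ψ')) ∂(multivariateGaussian 0 (A * Aᵀ)))⁻¹ *
                      (∫ ω : EuclideanSpace ℝ (Site d ((n + 1) * s)), exp (-U (ω + ψ')) * U'' (ω + ψ') (EuclideanSpace.single z (1 : ℝ)) (EuclideanSpace.single s₅ (1 : ℝ)) ∂(multivariateGaussian 0 (A * Aᵀ))))) *
                  (U' (ω + ψ') (EuclideanSpace.single tt (1 : ℝ)) -
                    ((∫ ω : EuclideanSpace ℝ (Site d ((n + 1) * s)), exp (-U (ω + ψ')) ∂(multivariateGaussian 0 (A * Aᵀ)))⁻¹ *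
                      (∫ ω : EuclideanSpace ℝ (Site d ((n + 1) * s)), exp (-U (ω + ψ')) * U' (ω + ψ') (EuclideanSpace.single tt (1 : ℝ)) ∂(multivariateGaussian 0 (A * Aᵀ)))))) ∂(multivariateGaussian 0 (A * Aᵀ))) +
              (∫ ω : EuclideanSpace ℝ (Site d ((n + 1) * s)), exp (-U (ω + ψ')) ∂(multivariateGaussian 0 (A * Aᵀ)))⁻¹ *
              (∫ ω : EuclideanSpace ℝ (Site d ((n + 1) * s)), exp (-U (ω + ψ')) *
                ((U' (ω + ψ') (EuclideanSpace.single y (1 : ℝ)) -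
                    ((∫ ω : EuclideanSpace ℝ (Site d ((n + 1) * s)), exp (-U (ω + ψ')) ∂(multivariateGaussian 0 (A * Aᵀ)))⁻¹ *
                      (∫ ω : EuclideanSpace ℝ (Site d ((n + 1) * s)), exp (-U (ω + ψ')) * U' (ω + ψ') (EuclideanSpace.single y (1 : ℝ)) ∂(multivariateGaussian 0 (A * Aᵀ))))) *
                  (U'' (ω + ψ') (EuclideanSpace.single tt (1 : ℝ)) (EuclideanSpace.single s₅ (1 : ℝ)) -
                    ((∫ ω : EuclideanSpace ℝ (Site d ((n + 1) * s)), exp (-U (ω + ψ')) ∂(multivariateGaussian 0 (A * Aᵀ)))⁻¹ *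
                      (∫ ω : EuclideanSpace ℝ (Site d ((n + 1) * s)), exp (-U (ω + ψ')) * U'' (ω + ψ') (EuclideanSpace.single tt (1 : ℝ)) (EuclideanSpace.single s₅ (1 : ℝ)) ∂(multivariateGaussian 0 (A * Aᵀ))))) *
                  (U' (ω + ψ') (EuclideanSpace.single z (1 : ℝ)) -
                    ((∫ ω : EuclideanSpace ℝ (Site d ((n + 1) * s)), exp (-U (ω + ψ')) ∂(multivariateGaussian 0 (A * Aᵀ)))⁻¹ *
                      (∫ ω : EuclideanSpace ℝ (Site d ((n + 1) * s)), exp (-U (ω + ψ')) * U' (ω + ψ') (EuclideanSpace.single z (1 : ℝ)) ∂(multivariateGaussian 0 (A * Aᵀ)))))) ∂(multivariateGaussian 0 (A * Aᵀ)))) -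
            ((∫ ω : EuclideanSpace ℝ (Site d ((n + 1) * s)), exp (-U (ω + ψ')) ∂(multivariateGaussian 0 (A * Aᵀ)))⁻¹ *
              (∫ ω : EuclideanSpace ℝ (Site d ((n + 1) * s)), exp (-U (ω + ψ')) *
                ((U' (ω + ψ') (EuclideanSpace.single y (1 : ℝ)) -
                    ((∫ ω : EuclideanSpace ℝ (Site d ((n + 1) * s)), exp (-U (ω + ψ')) ∂(multivariateGaussian 0 (A * Aᵀ)))⁻¹ *
                      (∫ ω : EuclideanSpace ℝ (Site d ((n + 1) * s)), exp (-U (ω + ψ')) * U' (ω + ψ') (EuclideanSpace.single y (1 : ℝ)) ∂(multivariateGaussian 0 (A * Aᵀ))))) *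
                  (U' (ω + ψ') (EuclideanSpace.single z (1 : ℝ)) -
                    ((∫ ω : EuclideanSpace ℝ (Site d ((n + 1) * s)), exp (-U (ω + ψ')) ∂(multivariateGaussian 0 (A * Aᵀ)))⁻¹ *
                      (∫ ω : EuclideanSpace ℝ (Site d ((n + 1) * s)), exp (-U (ω + ψ')) * U' (ω + ψ') (EuclideanSpace.single z (1 : ℝ)) ∂(multivariateGaussian 0 (A * Aᵀ))))) *
                  (U' (ω + ψ') (EuclideanSpace.single tt (1 : ℝ)) -
                    ((∫ ω : EuclideanSpace ℝ (Site d ((n + 1) * s)), exp (-U (ω + ψ')) ∂(multivariateGaussian 0 (A * Aᵀ)))⁻¹ *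
                      (∫ ω : EuclideanSpace ℝ (Site d ((n + 1) * s)), exp (-U (ω + ψ')) * U' (ω + ψ') (EuclideanSpace.single tt (1 : ℝ)) ∂(multivariateGaussian 0 (A * Aᵀ))))) *
                  (U' (ω + ψ') (EuclideanSpace.single s₅ (1 : ℝ)) -
                    ((∫ ω : EuclideanSpace ℝ (Site d ((n + 1) * s)), exp (-U (ω + ψ')) ∂(multivariateGaussian 0 (A * Aᵀ)))⁻¹ *
                      (∫ ω : EuclideanSpace ℝ (Site d ((n + 1) * s)), exp (-U (ω + ψ')) * U' (ω + ψ') (EuclideanSpace.single s₅ (1 : ℝ)) ∂(multivariateGaussian 0 (A * Aᵀ)))))) ∂(multivariateGaussian 0 (A * Aᵀ))) -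
              ((∫ ω : EuclideanSpace ℝ (Site d ((n + 1) * s)), exp (-U (ω + ψ')) ∂(multivariateGaussian 0 (A * Aᵀ)))⁻¹ *
                (∫ ω : EuclideanSpace ℝ (Site d ((n + 1) * s)), exp (-U (ω + ψ')) *
                  ((U' (ω + ψ') (EuclideanSpace.single y (1 : ℝ)) -
                      ((∫ ω : EuclideanSpace ℝ (Site d ((n + 1) * s)), exp (-U (ω + ψ')) ∂(multivariateGaussian 0 (A * Aᵀ)))⁻¹ *
                        (∫ ω : EuclideanSpace ℝ (Site d ((n + 1) * s)), exp (-U (ω + ψ')) * U' (ω + ψ') (EuclideanSpace.single y (1 : ℝ)) ∂(multivariateGaussian 0 (A * Aᵀ))))) *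
                    (U' (ω + ψ') (EuclideanSpace.single z (1 : ℝ)) -
                      ((∫ ω : EuclideanSpace ℝ (Site d ((n + 1) * s)), exp (-U (ω + ψ')) ∂(multivariateGaussian 0 (A * Aᵀ)))⁻¹ *
                        (∫ ω : EuclideanSpace ℝ (Site d ((n + 1) * s)), exp (-U (ω + ψ')) * U' (ω + ψ') (EuclideanSpace.single z (1 : ℝ)) ∂(multivariateGaussian 0 (A * Aᵀ)))))) ∂(multivariateGaussian 0 (A * Aᵀ)))) *
              ((∫ ω : EuclideanSpace ℝ (Site d ((n + 1) * s)), exp (-U (ω + ψ')) ∂(multivariateGaussian 0 (A * Aᵀ)))⁻¹ *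
                (∫ ω : EuclideanSpace ℝ (Site d ((n + 1) * s)), exp (-U (ω + ψ')) *
                  ((U' (ω + ψ') (EuclideanSpace.single tt (1 : ℝ)) -
                      ((∫ ω : EuclideanSpace ℝ (Site d ((n + 1) * s)), exp (-U (ω + ψ')) ∂(multivariateGaussian 0 (A * Aᵀ)))⁻¹ *
                        (∫ ω : EuclideanSpace ℝ (Site d ((n + 1) * s)), exp (-U (ω + ψ')) * U' (ω + ψ') (EuclideanSpace.single tt (1 : ℝ)) ∂(multivariateGaussian 0 (A * Aᵀ))))) *
                    (U' (ω + ψ') (EuclideanSpace.single s₅ (1 : ℝ)) -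
                      ((∫ ω : EuclideanSpace ℝ (Site d ((n + 1) * s)), exp (-U (ω + ψ')) ∂(multivariateGaussian 0 (A * Aᵀ)))⁻¹ *
                        (∫ ω : EuclideanSpace ℝ (Site d ((n + 1) * s)), exp (-U (ω + ψ')) * U' (ω + ψ') (EuclideanSpace.single s₅ (1 : ℝ)) ∂(multivariateGaussian 0 (A * Aᵀ)))))) ∂(multivariateGaussian 0 (A * Aᵀ)))) -
              ((∫ ω : EuclideanSpace ℝ (Site d ((n + 1) * s)), exp (-U (ω + ψ')) ∂(multivariateGaussian 0 (A * Aᵀ)))⁻¹ *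
                (∫ ω : EuclideanSpace ℝ (Site d ((n + 1) * s)), exp (-U (ω + ψ')) *
                  ((U' (ω + ψ') (EuclideanSpace.single y (1 : ℝ)) -
                      ((∫ ω : EuclideanSpace ℝ (Site d ((n + 1) * s)), exp (-U (ω + ψ')) ∂(multivariateGaussian 0 (A * Aᵀ)))⁻¹ *
                        (∫ ω : EuclideanSpace ℝ (Site d ((n + 1) * s)), exp (-U (ω + ψ')) * U' (ω + ψ') (EuclideanSpace.single y (1 : ℝ)) ∂(multivariateGaussian 0 (A * Aᵀ))))) *
                    (U' (ω + ψ') (EuclideanSpace.single tt (1 : ℝ)) -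
                      ((∫ ω : EuclideanSpace ℝ (Site d ((n + 1) * s)), exp (-U (ω + ψ')) ∂(multivariateGaussian 0 (A * Aᵀ)))⁻¹ *
                        (∫ ω : EuclideanSpace ℝ (Site d ((n + 1) * s)), exp (-U (ω + ψ')) * U' (ω + ψ') (EuclideanSpace.single tt (1 : ℝ)) ∂(multivariateGaussian 0 (A * Aᵀ)))))) ∂(multivariateGaussian 0 (A * Aᵀ)))) *
              ((∫ ω : EuclideanSpace ℝ (Site d ((n + 1) * s)), exp (-U (ω + ψ')) ∂(multivariateGaussian 0 (A * Aᵀ)))⁻¹ *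
                (∫ ω : EuclideanSpace ℝ (Site d ((n + 1) * s)), exp (-U (ω + ψ')) *
                  ((U' (ω + ψ') (EuclideanSpace.single z (1 : ℝ)) -
                      ((∫ ω : EuclideanSpace ℝ (Site d ((n + 1) * s)), exp (-U (ω + ψ')) ∂(multivariateGaussian 0 (A * Aᵀ)))⁻¹ *
                        (∫ ω : EuclideanSpace ℝ (Site d ((n + 1) * s)), exp (-U (ω + ψ')) * U' (ω + ψ') (EuclideanSpace.single z (1 : ℝ)) ∂(multivariateGaussian 0 (A * Aᵀ))))) *
                    (U' (ω + ψ') (EuclideanSpace.single s₅ (1 : ℝ)) -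
                      ((∫ ω : EuclideanSpace ℝ (Site d ((n + 1) * s)), exp (-U (ω + ψ')) ∂(multivariateGaussian 0 (A * Aᵀ)))⁻¹ *
                        (∫ ω : EuclideanSpace ℝ (Site d ((n + 1) * s)), exp (-U (ω + ψ')) * U' (ω + ψ') (EuclideanSpace.single s₅ (1 : ℝ)) ∂(multivariateGaussian 0 (A * Aᵀ)))))) ∂(multivariateGaussian 0 (A * Aᵀ)))) -
              ((∫ ω : EuclideanSpace ℝ (Site d ((n + 1) * s)), exp (-U (ω + ψ')) ∂(multivariateGaussian 0 (A * Aᵀ)))⁻¹ *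
                (∫ ω : EuclideanSpace ℝ (Site d ((n + 1) * s)), exp (-U (ω + ψ')) *
                  ((U' (ω + ψ') (EuclideanSpace.single y (1 : ℝ)) -
                      ((∫ ω : EuclideanSpace ℝ (Site d ((n + 1) * s)), exp (-U (ω + ψ')) ∂(multivariateGaussian 0 (A * Aᵀ)))⁻¹ *
                        (∫ ω : EuclideanSpace ℝ (Site d ((n + 1) * s)), exp (-U (ω + ψ')) * U' (ω + ψ') (EuclideanSpace.single y (1 : ℝ)) ∂(multivariateGaussian 0 (A * Aᵀ))))) *
                    (U' (ω + ψ') (EuclideanSpace.single s₅ (1 : ℝ)) -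
                      ((∫ ω : EuclideanSpace ℝ (Site d ((n + 1) * s)), exp (-U (ω + ψ')) ∂(multivariateGaussian 0 (A * Aᵀ)))⁻¹ *
                        (∫ ω : EuclideanSpace ℝ (Site d ((n + 1) * s)), exp (-U (ω + ψ')) * U' (ω + ψ') (EuclideanSpace.single s₅ (1 : ℝ)) ∂(multivariateGaussian 0 (A * Aᵀ)))))) ∂(multivariateGaussian 0 (A * Aᵀ)))) *
              ((∫ ω : EuclideanSpace ℝ (Site d ((n + 1) * s)), exp (-U (ω + ψ')) ∂(multivariateGaussian 0 (A * Aᵀ)))⁻¹ *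
                (∫ ω : EuclideanSpace ℝ (Site d ((n + 1) * s)), exp (-U (ω + ψ')) *
                  ((U' (ω + ψ') (EuclideanSpace.single z (1 : ℝ)) -
                      ((∫ ω : EuclideanSpace ℝ (Site d ((n + 1) * s)), exp (-U (ω + ψ')) ∂(multivariateGaussian 0 (A * Aᵀ)))⁻¹ *
                        (∫ ω : EuclideanSpace ℝ (Site d ((n + 1) * s)), exp (-U (ω + ψ')) * U' (ω + ψ') (EuclideanSpace.single z (1 : ℝ)) ∂(multivariateGaussian 0 (A * Aᵀ))))) *
                    (U' (ω + ψ') (EuclideanSpace.single tt (1 : ℝ)) -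
                      ((∫ ω : EuclideanSpace ℝ (Site d ((n + 1) * s)), exp (-U (ω + ψ')) ∂(multivariateGaussian 0 (A * Aᵀ)))⁻¹ *
                        (∫ ω : EuclideanSpace ℝ (Site d ((n + 1) * s)), exp (-U (ω + ψ')) * U' (ω + ψ') (EuclideanSpace.single tt (1 : ℝ)) ∂(multivariateGaussian 0 (A * Aᵀ)))))) ∂(multivariateGaussian 0 (A * Aᵀ)))))) ψ
          (EuclideanSpace.single x (1 : ℝ))|) *
        (Real.exp (νc * ∑ i, (((Xc i - Yc i).valMinAbs.natAbs : ℕ) : ℝ)) * Real.exp (νc * ∑ i, (((Xc i - Zc i).valMinAbs.natAbs : ℕ) : ℝ)) * Real.exp (νc * ∑ i, (((Xc i - Tc i).valMinAbs.natAbs : ℕ) : ℝ)) * Real.exp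
          (νc * ∑ i, (((Xc i - y₁ i).valMinAbs.natAbs : ℕ) : ℝ)) * Real.exp (νc * ∑ i, (((Yc i - Zc i).valMinAbs.natAbs : ℕ) : ℝ)) * Real.exp (νc * ∑ i, (((Yc i - Tc i).valMinAbs.natAbs : ℕ) : ℝ)) * Real.exp
          (νc * ∑ i, (((Yc i - y₁ i).valMinAbs.natAbs : ℕ) : ℝ)) * Real.exp (νc * ∑ i, (((Zc i - Tc i).valMinAbs.natAbs : ℕ) : ℝ)) * Real.exp (νc * ∑ i, (((Zc i - y₁ i).valMinAbs.natAbs : ℕ) : ℝ)) * Real.exp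
          (νc * ∑ i, (((Tc i - y₁ i).valMinAbs.natAbs : ℕ) : ℝ))) ≤
      |t| ^ 5 * (((n + 1) ^ d : ℕ) : ℝ) * Real.exp (νc * ((d : ℝ) * n / ((n : ℝ) + 1))) ^ 10 *
          ((k5ϑ4 + dθ * αk5m4 * (dθ' * αθc) / (1 - lamA) + dθ * αk5m4 * (dθ' * αθc) / (1 - lamA) + dθ * αk4m3 * (dθ' * αg1c) / (1 - lamA) + Real.sqrt (2 * Real.sqrt (5 * (κ₂ ^ 4 * γop ^ 2) / (1 - lam * γop) ^ 2) * C3k) *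
              (Real.sqrt (k3mϑ * (Θ8 * Θ8)) * (G * G)) + dθ * αk5m4 * (dθ' * αθc) / (1 - lamA) + dθ * αk4m3 * (dθ' * αg1c) / (1 - lamA) + Real.sqrt (2 * Real.sqrt (5 * (κ₂ ^ 4 * γop ^ 2) / (1 - lam * γop) ^ 2) * C3k) *
              (Real.sqrt (k3mϑ * (Θ8 * Θ8)) * (G * G)) + dθ * αθ * (dθ' * αk5c) / (1 - lamA)) +
            (dθ * αg2m * (dθ' * αk4c) / (1 - lamA) + Real.sqrt (2 * Real.sqrt (5 * (κ₂ ^ 4 * γop ^ 2) / (1 - lam * γop) ^ 2) * C3k) * (G * (G * Real.sqrt (k3cϑ * (Θ8 * Θ8)))) + dθ * αk4m3 * (dθ' * αg1c) / (1 - lamA) + dθ * αk5m4 *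
              (dθ' * αθc) / (1 - lamA) + Real.sqrt (2 * Real.sqrt (5 * (κ₂ ^ 4 * γop ^ 2) / (1 - lam * γop) ^ 2) * C3k) * (Real.sqrt (k3mϑ * (Θ8 * Θ8)) * (G * G)) + dθ * αg2m * (dθ' * αk4c) / (1 - lamA) + dθ * αk4m3 * (dθ' * αg1c)
              / (1 - lamA) + Real.sqrt (4 * Real.sqrt (Real.sqrt (5 * (κ₂ ^ 4 * γop ^ 2) / (1 - lam * γop) ^ 2)) * C3h) * (Real.sqrt (hrϑ * Θ8) * (G * (G * Real.sqrt (hcϑ * Θ8))))) +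
            (dθ * αg2m * (dθ' * αk4c) / (1 - lamA) + dθ * αk4m3 * (dθ' * αg1c) / (1 - lamA) + Real.sqrt (4 * Real.sqrt (Real.sqrt (5 * (κ₂ ^ 4 * γop ^ 2) / (1 - lam * γop) ^ 2)) * C3h) *
              (Real.sqrt (hrϑ * Θ8) * (G * (G * Real.sqrt (hcϑ * Θ8)))) + dθ * αk4m3 * (dθ' * αg1c) / (1 - lamA) + dθ * αg2m * (dθ' * αk4c) / (1 - lamA) + Real.sqrt
              (4 * Real.sqrt (Real.sqrt (5 * (κ₂ ^ 4 * γop ^ 2) / (1 - lam * γop) ^ 2)) * C3h) * (Real.sqrt (hrϑ * Θ8) * (G * (G * Real.sqrt (hcϑ * Θ8)))) + Real.sqrt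
              (2 * Real.sqrt (5 * (κ₂ ^ 4 * γop ^ 2) / (1 - lam * γop) ^ 2) * C3k) * (G * (G * Real.sqrt (k3cϑ * (Θ8 * Θ8)))) + Real.sqrt (4 * Real.sqrt (Real.sqrt (5 * (κ₂ ^ 4 * γop ^ 2) / (1 - lam * γop) ^ 2)) * C3h) *
              (G * (G * (Real.sqrt (hcϑ * Θ8) * Real.sqrt (hcϑ * Θ8))))) +
            (Real.sqrt (4 * Real.sqrt (Real.sqrt (5 * (κ₂ ^ 4 * γop ^ 2) / (1 - lam * γop) ^ 2)) * C3h) * (Real.sqrt (hrϑ * Θ8) * (G * (G * Real.sqrt (hcϑ * Θ8)))) + Real.sqrt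
              (16 * (8 * (Real.sqrt (5 * (κ₂ ^ 4 * γop ^ 2) / (1 - lam * γop) ^ 2) * Real.sqrt (Real.sqrt (5 * (κ₂ ^ 4 * γop ^ 2) / (1 - lam * γop) ^ 2))) * C4)) * (S2 * (S2 * (Real.sqrt (hcϑ * Θ8) * S2))) + Real.sqrt
              (2 * Real.sqrt (5 * (κ₂ ^ 4 * γop ^ 2) / (1 - lam * γop) ^ 2) * C3k) * (G * (G * Real.sqrt (k3cϑ * (Θ8 * Θ8)))) + Real.sqrt (4 * Real.sqrt (Real.sqrt (5 * (κ₂ ^ 4 * γop ^ 2) / (1 - lam * γop) ^ 2)) * C3h) *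
              (G * (G * (Real.sqrt (hcϑ * Θ8) * Real.sqrt (hcϑ * Θ8)))) + Real.sqrt (4 * Real.sqrt (Real.sqrt (5 * (κ₂ ^ 4 * γop ^ 2) / (1 - lam * γop) ^ 2)) * C3h) * (Real.sqrt (hrϑ * Θ8) * (G * (G * Real.sqrt (hcϑ * Θ8)))) +
              Real.sqrt (16 * (8 * (Real.sqrt (5 * (κ₂ ^ 4 * γop ^ 2) / (1 - lam * γop) ^ 2) * Real.sqrt (Real.sqrt (5 * (κ₂ ^ 4 * γop ^ 2) / (1 - lam * γop) ^ 2))) * C4)) * (S2 * (S2 * (S2 * Real.sqrt (hcϑ * Θ8)))) + Real.sqrt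
              (2 * Real.sqrt (5 * (κ₂ ^ 4 * γop ^ 2) / (1 - lam * γop) ^ 2) * C3k) * (Real.sqrt (k3mϑ * (Θ8 * Θ8)) * (G * G))) +
            (Real.sqrt (4 * Real.sqrt (Real.sqrt (5 * (κ₂ ^ 4 * γop ^ 2) / (1 - lam * γop) ^ 2)) * C3h) * (Real.sqrt (hrϑ * Θ8) * (G * (Real.sqrt (hcϑ * Θ8) * G))) + Real.sqrt
              (4 * Real.sqrt (Real.sqrt (5 * (κ₂ ^ 4 * γop ^ 2) / (1 - lam * γop) ^ 2)) * C3h) * (Real.sqrt (hrϑ * Θ8) * (G * (G * Real.sqrt (hcϑ * Θ8)))) + Real.sqrt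
              (16 * (8 * (Real.sqrt (5 * (κ₂ ^ 4 * γop ^ 2) / (1 - lam * γop) ^ 2) * Real.sqrt (Real.sqrt (5 * (κ₂ ^ 4 * γop ^ 2) / (1 - lam * γop) ^ 2))) * C4)) * (Real.sqrt (hrϑ * Θ8) * (S2 * (S2 * S2))) + Real.sqrt
              (4 * Real.sqrt (Real.sqrt (5 * (κ₂ ^ 4 * γop ^ 2) / (1 - lam * γop) ^ 2)) * C3h) * (G * (Real.sqrt (hcϑ * Θ8) * (G * Real.sqrt (hcϑ * Θ8)))) + Real.sqrt
              (2 * Real.sqrt (5 * (κ₂ ^ 4 * γop ^ 2) / (1 - lam * γop) ^ 2) * C3k) * (G * (G * Real.sqrt (k3cϑ * (Θ8 * Θ8)))) + Real.sqrt (4 * Real.sqrt (Real.sqrt (5 * (κ₂ ^ 4 * γop ^ 2) / (1 - lam * γop) ^ 2)) * C3h) *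
              (Real.sqrt (hrϑ * Θ8) * (G * (G * Real.sqrt (hcϑ * Θ8)))) + Real.sqrt
              (16 * (8 * (Real.sqrt (5 * (κ₂ ^ 4 * γop ^ 2) / (1 - lam * γop) ^ 2) * Real.sqrt (Real.sqrt (5 * (κ₂ ^ 4 * γop ^ 2) / (1 - lam * γop) ^ 2))) * C4)) * (S2 * (S2 * (S2 * Real.sqrt (hcϑ * Θ8))))) +
            (Real.sqrt (4 * Real.sqrt (Real.sqrt (5 * (κ₂ ^ 4 * γop ^ 2) / (1 - lam * γop) ^ 2)) * C3h) * (Real.sqrt (hrϑ * Θ8) * (G * (Real.sqrt (hcϑ * Θ8) * G))) + Real.sqrt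
              (2 * Real.sqrt (5 * (κ₂ ^ 4 * γop ^ 2) / (1 - lam * γop) ^ 2) * C3k) * (Real.sqrt (k3mϑ * (Θ8 * Θ8)) * (G * G)) + Real.sqrt (4 * Real.sqrt (Real.sqrt (5 * (κ₂ ^ 4 * γop ^ 2) / (1 - lam * γop) ^ 2)) * C3h) *
              (Real.sqrt (hrϑ * Θ8) * (G * (G * Real.sqrt (hcϑ * Θ8)))) + Real.sqrt
              (16 * (8 * (Real.sqrt (5 * (κ₂ ^ 4 * γop ^ 2) / (1 - lam * γop) ^ 2) * Real.sqrt (Real.sqrt (5 * (κ₂ ^ 4 * γop ^ 2) / (1 - lam * γop) ^ 2))) * C4)) * (Real.sqrt (hrϑ * Θ8) * (S2 * (S2 * S2))) + Real.sqrt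
              (4 * Real.sqrt (Real.sqrt (5 * (κ₂ ^ 4 * γop ^ 2) / (1 - lam * γop) ^ 2)) * C3h) * (Real.sqrt (hrϑ * Θ8) * (G * (Real.sqrt (hcϑ * Θ8) * G))) + Real.sqrt
              (2 * Real.sqrt (5 * (κ₂ ^ 4 * γop ^ 2) / (1 - lam * γop) ^ 2) * C3k) * (Real.sqrt (k3mϑ * (Θ8 * Θ8)) * (G * G)) + Real.sqrt (4 * Real.sqrt (Real.sqrt (5 * (κ₂ ^ 4 * γop ^ 2) / (1 - lam * γop) ^ 2)) * C3h) *
              (Real.sqrt (hrϑ * Θ8) * (G * (G * Real.sqrt (hcϑ * Θ8))))) +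
            (Real.sqrt (16 * (8 * (Real.sqrt (5 * (κ₂ ^ 4 * γop ^ 2) / (1 - lam * γop) ^ 2) * Real.sqrt (Real.sqrt (5 * (κ₂ ^ 4 * γop ^ 2) / (1 - lam * γop) ^ 2))) * C4)) * (Real.sqrt (hrϑ * Θ8) * (S2 * (S2 * S2))) + Real.sqrt
              (16 * (8 * (Real.sqrt (5 * (κ₂ ^ 4 * γop ^ 2) / (1 - lam * γop) ^ 2) * Real.sqrt (Real.sqrt (5 * (κ₂ ^ 4 * γop ^ 2) / (1 - lam * γop) ^ 2))) * C4)) * (S2 * (Real.sqrt (hcϑ * Θ8) * (S2 * S2))) + Real.sqrt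
              (16 * (8 * (Real.sqrt (5 * (κ₂ ^ 4 * γop ^ 2) / (1 - lam * γop) ^ 2) * Real.sqrt (Real.sqrt (5 * (κ₂ ^ 4 * γop ^ 2) / (1 - lam * γop) ^ 2))) * C4)) * (S2 * (S2 * (Real.sqrt (hcϑ * Θ8) * S2))) + Real.sqrt
              (16 * (8 * (Real.sqrt (5 * (κ₂ ^ 4 * γop ^ 2) / (1 - lam * γop) ^ 2) * Real.sqrt (Real.sqrt (5 * (κ₂ ^ 4 * γop ^ 2) / (1 - lam * γop) ^ 2))) * C4)) * (S2 * (S2 * (S2 * Real.sqrt (hcϑ * Θ8)))) + Real.sqrt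
              (16 * (8 * (Real.sqrt (5 * (κ₂ ^ 4 * γop ^ 2) / (1 - lam * γop) ^ 2) * Real.sqrt (Real.sqrt (5 * (κ₂ ^ 4 * γop ^ 2) / (1 - lam * γop) ^ 2))) * C4)) * (Real.sqrt (hrϑ * Θ8) * (S2 * (S2 * S2)))) +
            (C5 * (S2 * (S2 * (S2 * S2))))) :=
  classmap_five_step_s (ϑ := fun x y : (Site d ((n + 1) * s)) => Real.exp (ν * ∑ i, (((x i - y i).valMinAbs.natAbs : ℕ) : ℝ))) hΓop Y hUd hU'd hU''d hU₃d hU₄d hU₅c hκ₀ hκ₁ ha hτ hδ hθ0 hθ1 hκθ hκθw hstab hU'b hU''b hU₃b hU₄b hU₅b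
      hlam hUsec hρg hHk hHk0 hK3 hK30 hK4 hK40 hK5 hhr ψ hαr hαc hlamA hlamA1 hγ hγ1 hD hDC hθnn hDθr hdθ hDθc hdθ' hσ0 hσθ hρ1 hρsymm hρmul hρσ hr1 hrσ hC3k hC3h hC4 hC5 hr₁1 hr₁symm hr₁mul hr₁8 hC40 hC50
      (fun x y => torus_weight_one_le ((n + 1) * s) hν x y) (fun x y => torus_weight_symm ((n + 1) * s) ν x y) hϑmul hϑ4 hϑ₂symm hϑσ6 hϑr₁ hG hΘ hS2 hhrw hhc hk3m hk3c hk5 hσA0 hσϑ₂ hAr hAc hαcσ0 hk3r hk4y hk4t hk4x hk5x hαθ hαθ'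
      hαθ'' hαβ hαθc hαg2m hαg1c hαk4m3 hαk4c hαk5m4 hαk5c
    (fun x : (Site d ((n + 1) * s)) => siteOf d s (blk n (windowMap d ((n + 1) * s) x))) (fibre_card_le n s) (M := Real.exp (νc * ((d : ℝ) * n / ((n : ℝ) + 1))))
    (ϑc := fun y y' : Site d s => Real.exp (νc * ∑ i, (((y i - y' i).valMinAbs.natAbs : ℕ) : ℝ))) (Real.exp_pos _).le (fun y y' => (torus_weight_pos s νc y y').le) (fun y y' => torus_weight_symm s νc y y')
    (fun x x' => torus_block_factor n s hνc hrate x x') t y₁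

/-! ## Toy -/

/-- Toy (the instance's factor in numbers): `d = 4`, `n + 1 = 2`, `t = 1∕2`, `νc = 0`: `|t|⁵·(n+1)^d·M¹⁰ = 16∕32 = 1∕2` — order 5 contracts. -/
example : |(1 : ℝ) / 2| ^ 5 * 16 * (1 : ℝ) ^ 10 = 1 / 2 := by norm_num

end Summit.QuantumFields.BalabanUV.T4Continuum.NE7b.SupWeightedClassMapOrderFiveStepFiveTorus

end
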